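import Literature.Probability.RandomPlanarGeometry.HexSAWSurfaceWallRenewalKendall
import Literature.Probability.RandomPlanarGeometry.HexSAWSurfaceWallRenewalCubeRange
import HarnessLib

/-!
# A geometric RATE for the renewal theorem of adsorbed wall bridges down to `y > μ³` (Kendall's theorem instantiated with the
# six-step envelope)

Topic `Literature/Probability/RandomPlanarGeometry` (lane «pcv-sawmu», a-p6 g19, car «KENDALL-CUBE»; parents, all TREE:
`HexSAWSurfaceWallRenewalKendall.lean` (the `μ⁴`-range instantiation of the tree's quantitative Kendall theorem
`Process/RenewalKendallRate.lean`, `Renewal.kendall_abs_sub_inv_le_of_geometric`, with the entropy envelope `θ = μ²/√y`),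
`HexSAWSurfaceWallRenewalCubeRange.lean` (a-p6 g19: `hasSum_pwbLaw_of_cube_lt`, `summable_mul_pwbLaw_of_cube_lt`, the six-step envelope
`pwbLaw_le_geom_cube : f_k ≤ (μ² + y^{2/3}/μ²) θ₃^k`, `θ₃ = μ²/y^{2/3} < 1` iff `y > μ³` (`theta_cube_lt_one`)), `HexSAWSurfaceWallRenewal.lean`
(`pwbAmp`, `pwbLaw`, `pwbMean`, `pwbLaw_one_pos`)).

WHAT IS PROVED — the parent's three theorems VERBATIM IN FORM on `y > μ³ = (2+√2)^{3/2}` with `θ₃`, `C₃ = μ² + y^{2/3}/μ²`, `A = C₃θ₃/(1−θ₃)`: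
`one_sub_sum_pwbLaw_le_of_cube_lt` (tail envelope `1 − Σ_{k≤n} f_k ≤ A θ₃^n`), `abs_pwbAmp_sub_inv_pwbMean_le_kendall_of_cube_lt` (explicit form),
★★ `exists_geometric_rate_pwbAmp_of_cube_lt` / `exists_geometric_rate_PWB_div_of_cube_lt` — for EVERY `y > μ³` there are `ρ > 1`, `K` with
`|P_{2s}(y)/β(y)^{2s} − 1/m(y)| ≤ K ρ^{−s}` (the tree had `y > μ⁴`).

HONEST LABEL.  LANE THEOREM (range extension), DERIVED; sources as in the parent: [MadrasSlade1993, §4.2 Theorem 4.2.2(b) (pp. 91–92) and Theorem 4.2.5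
(p. 95)], [Bednorz2013, §2, Corollary 2.5 (p. 5)], [Feller1968, XIII.3], [BeatonBousquetMelouDeGierDuminilCopinGuttmann2014, §3.1].  NEW IN WRITING
(modest): the geometric rate on the explicit range `y > (2+√2)^{3/2}`.  NOT CLAIMED: `y ≤ μ³`; an optimal rate; numerics.  No definitions.
-/

noncomputable section

open Finset Filter
open _root_.Topology

namespace Literature.Probability.RandomPlanarGeometry.SAW.HexBW.Wall

variable {y : ℝ}

/-- [folklore] `μ³ < y` forces `0 < y` and `1 ≤ y` (`1 ≤ μ`). -/
private theorem pos_and_one_le_of_mu_cube_lt_kdc (hy : hexConnectiveConstant ^ 3 < y) : 0 < y ∧ 1 ≤ y := by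
  have h1 : (1 : ℝ) ≤ hexConnectiveConstant ^ 3 := one_le_pow₀ one_le_hexConnectiveConstant
  exact ⟨by linarith, by linarith⟩

/-- [folklore] `0 < θ₃(y) = μ²/y^{2/3} < 1` for `μ³ < y`. -/
private theorem theta_cube_pos_lt_one_kdc (hy : hexConnectiveConstant ^ 3 < y) :
    0 < hexConnectiveConstant ^ 2 / y ^ ((2 : ℝ) / 3) ∧ hexConnectiveConstant ^ 2 / y ^ ((2 : ℝ) / 3) < 1 :=
  ⟨div_pos (pow_pos hexConnectiveConstant_pos 2) (Real.rpow_pos_of_pos (pos_and_one_le_of_mu_cube_lt_kdc hy).1 _),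
    theta_cube_lt_one hy⟩

/-- **Tail envelope of the irreducible law**: for `y > μ³` and every `n`,
`r_n(y) = 1 − Σ_{k ≤ n} f_k(y) = Σ_{k > n} f_k(y) ≤ C₃θ₃/(1 − θ₃) · θ₃^n`, `θ₃ = μ²/y^{2/3}`, `C₃ = μ² + y^{2/3}/μ²` — from `Σ f = 1`
and the six-step envelope `f_k ≤ C₃ θ₃^k`. [cite: MadrasSlade1993, §4.2, remark before (4.2.21) (p. 94)] [cite: Feller1968, XIII.3] -/
theorem one_sub_sum_pwbLaw_le_of_cube_lt (hy : hexConnectiveConstant ^ 3 < y) (n : ℕ) :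
    1 - ∑ k ∈ range (n + 1), pwbLaw y k ≤
      (hexConnectiveConstant ^ 2 + y ^ ((2 : ℝ) / 3) / hexConnectiveConstant ^ 2) * (hexConnectiveConstant ^ 2 / y ^ ((2 : ℝ) / 3)) / (1 - hexConnectiveConstant ^ 2 / y ^ ((2 : ℝ) / 3)) *
        (hexConnectiveConstant ^ 2 / y ^ ((2 : ℝ) / 3)) ^ n := by
  obtain ⟨hy0, hy1⟩ := pos_and_one_le_of_mu_cube_lt_kdc hy
  obtain ⟨hθ0, hθ1⟩ := theta_cube_pos_lt_one_kdc hy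
  set θ := hexConnectiveConstant ^ 2 / y ^ ((2 : ℝ) / 3) with hθ
  set C := hexConnectiveConstant ^ 2 + y ^ ((2 : ℝ) / 3) / hexConnectiveConstant ^ 2 with hC
  have htail : HasSum (fun k : ℕ => pwbLaw y (k + (n + 1))) (1 - ∑ k ∈ range (n + 1), pwbLaw y k) :=
    (hasSum_nat_add_iff' (n + 1)).2 (hasSum_pwbLaw_of_cube_lt hy)
  have hmaj : HasSum (fun k : ℕ => C * θ ^ (n + 1) * θ ^ k) (C * θ ^ (n + 1) * (1 - θ)⁻¹) :=
    (hasSum_geometric_of_lt_one hθ0.le hθ1).mul_left _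
  have hle : ∀ k : ℕ, pwbLaw y (k + (n + 1)) ≤ C * θ ^ (n + 1) * θ ^ k := fun k =>
    calc pwbLaw y (k + (n + 1)) ≤ C * θ ^ (k + (n + 1)) := pwbLaw_le_geom_cube hy1 _
      _ = C * θ ^ (n + 1) * θ ^ k := by rw [pow_add]; ring
  calc 1 - ∑ k ∈ range (n + 1), pwbLaw y k ≤ C * θ ^ (n + 1) * (1 - θ)⁻¹ := hasSum_le hle htail hmaj
    _ = C * θ / (1 - θ) * θ ^ n := by rw [pow_succ]; field_simp

/-- **Kendall's rate for adsorbed wall bridges, explicit form**: for `y > μ³`, `θ = θ₃ = μ²/y^{2/3}`, `A = C₃θ/(1 − θ)`,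
`b = f_1(y) = pwbLaw y 1`, and every radius `ρ` with `1 < ρ`, `ρθ < 1` and the margin inequality
`A(ρθ/(1−ρθ) − θ/(1−θ)) < b/(b + 2·Aθ/(1−θ)²)`:
`|PWB_{2s}(y) β(y)^{-2s} − 1/m(y)| ≤ ρ^{-s} / ((b/(b + 2Aθ/(1−θ)²) − A(ρθ/(1−ρθ) − θ/(1−θ)))·(ρ − 1))` for every `s`.
Instance of `Renewal.kendall_abs_sub_inv_le_of_geometric` with the tail envelope `one_sub_sum_pwbLaw_le_of_cube_lt` and the atom
`pwbLaw_one_pos`. [cite: Bednorz2013, §2, Corollary 2.5 (p. 5)] [cite: MadrasSlade1993, §4.2 Theorem 4.2.5 (p. 95)]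
[cite: Feller1968, XIII.3] -/
theorem abs_pwbAmp_sub_inv_pwbMean_le_kendall_of_cube_lt (hy : hexConnectiveConstant ^ 3 < y) {θ A ρ : ℝ}
    (hθ : θ = hexConnectiveConstant ^ 2 / y ^ ((2 : ℝ) / 3))
    (hA : A = (hexConnectiveConstant ^ 2 + y ^ ((2 : ℝ) / 3) / hexConnectiveConstant ^ 2) * θ / (1 - θ))
    (hρ : 1 < ρ) (hρθ : ρ * θ < 1)
    (hc : A * (ρ * θ / (1 - ρ * θ) - θ / (1 - θ)) < pwbLaw y 1 / (pwbLaw y 1 + 2 * (A * θ / (1 - θ) ^ 2))) (s : ℕ) :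
    |pwbAmp y s - (pwbMean y)⁻¹| ≤
      ρ⁻¹ ^ s / ((pwbLaw y 1 / (pwbLaw y 1 + 2 * (A * θ / (1 - θ) ^ 2)) - A * (ρ * θ / (1 - ρ * θ) - θ / (1 - θ))) * (ρ - 1)) := by
  obtain ⟨hy0, hy1⟩ := pos_and_one_le_of_mu_cube_lt_kdc hy
  obtain ⟨hθ0, hθ1⟩ := theta_cube_pos_lt_one_kdc hy
  rw [← hθ] at hθ0 hθ1
  have htail : ∀ j : ℕ, 1 ≤ j → 1 - ∑ k ∈ range (j + 1), pwbLaw y k ≤ A * θ ^ j := by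
    intro j _
    have h := one_sub_sum_pwbLaw_le_of_cube_lt hy j
    rw [← hθ, ← hA] at h
    exact h
  have h := Literature.Probability.Process.Renewal.kendall_abs_sub_inv_le_of_geometric
    (u := pwbAmp y) (f := pwbLaw y) (r := fun n => 1 - ∑ k ∈ range (n + 1), pwbLaw y k) (fun _ => rfl)
    pwbAmp_zero (pwbLaw_nonneg hy0.le) pwbLaw_zero (fun n hn => pwbAmp_eq_sum hn) (hasSum_pwbLaw_of_cube_lt hy)
    (summable_mul_pwbLaw_of_cube_lt hy) (pwbLaw_one_pos hy0) le_rfl hθ0 hρ hρθ htail hc s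
  simpa only [pwbMean] using h

/-- **Geometric rate of the renewal theorem for adsorbed wall bridges, for EVERY `y > μ³`**: there are `ρ > 1` and `K`
with `|PWB_{2s}(y) β(y)^{-2s} − 1/m(y)| ≤ K ρ^{-s}` for all `s`. The radius is exhibited: `ρ = (1 + ρ₀)/2` with
`ρ₀ = t/((1+t)θ) > 1`, `t = θ/(1−θ) + c/A`, `c = b/(b + 2Aθ/(1−θ)²)`, `A = C₃θ/(1−θ)`, `C₃ = μ² + y^{2/3}/μ²`, `b = f_1(y)`, `θ = μ²/y^{2/3}`
(so that `ρθ < t/(1+t) < 1` and the margin inequality of `abs_pwbAmp_sub_inv_pwbMean_le_kendall_of_cube_lt` holds).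
The tree's `tendsto_pwbAmp` is the rate-free statement. [cite: MadrasSlade1993, §4.2 Theorem 4.2.5 (p. 95)]
[cite: Bednorz2013, §2, Corollary 2.5 (p. 5)] [cite: Feller1968, XIII.3] -/
theorem exists_geometric_rate_pwbAmp_of_cube_lt (hy : hexConnectiveConstant ^ 3 < y) :
    ∃ ρ : ℝ, 1 < ρ ∧ ∃ K : ℝ, ∀ s : ℕ, |pwbAmp y s - (pwbMean y)⁻¹| ≤ K * ρ⁻¹ ^ s := by
  obtain ⟨hy0, hy1⟩ := pos_and_one_le_of_mu_cube_lt_kdc hy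
  obtain ⟨hθ0, hθ1⟩ := theta_cube_pos_lt_one_kdc hy
  set θ := hexConnectiveConstant ^ 2 / y ^ ((2 : ℝ) / 3) with hθ
  set A := (hexConnectiveConstant ^ 2 + y ^ ((2 : ℝ) / 3) / hexConnectiveConstant ^ 2) * θ / (1 - θ) with hA
  set b := pwbLaw y 1 with hb
  set M := A * θ / (1 - θ) ^ 2 with hM
  set c := b / (b + 2 * M) with hc
  have hb0 : 0 < b := pwbLaw_one_pos hy0
  have h1θ : 0 < 1 - θ := by linarith
  have hA0 : 0 < A := by rw [hA]; have := hexConnectiveConstant_pos; positivity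
  have hM0 : 0 ≤ M := by positivity
  have hc0 : 0 < c := by positivity
  set t := θ / (1 - θ) + c / A with ht
  have ht0 : θ / (1 - θ) < t := by have := div_pos hc0 hA0; linarith
  have htpos : 0 < t := lt_trans (div_pos hθ0 h1θ) ht0
  -- `θ < t/(1+t)`
  have hθt : θ < t / (1 + t) := by
    rw [lt_div_iff₀ (by linarith)]
    have h := (div_lt_iff₀ h1θ).1 ht0
    nlinarith
  set ρ₀ := t / ((1 + t) * θ) with hρ₀
  have hρ₀1 : 1 < ρ₀ := by
    rw [hρ₀, lt_div_iff₀ (by positivity), one_mul]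
    calc (1 + t) * θ < (1 + t) * (t / (1 + t)) := mul_lt_mul_of_pos_left hθt (by linarith)
      _ = t := by field_simp
  set ρ := (1 + ρ₀) / 2 with hρ
  have hρ1 : 1 < ρ := by rw [hρ]; linarith
  have hρρ₀ : ρ < ρ₀ := by rw [hρ]; linarith
  have hρθ' : ρ * θ < t / (1 + t) := by
    calc ρ * θ < ρ₀ * θ := mul_lt_mul_of_pos_right hρρ₀ hθ0
      _ = t / (1 + t) := by rw [hρ₀]; field_simp
  have hρθ : ρ * θ < 1 := hρθ'.trans (by rw [div_lt_one (by linarith)]; linarith)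
  -- the margin inequality: `ρθ/(1−ρθ) < t`
  have hmargin : A * (ρ * θ / (1 - ρ * θ) - θ / (1 - θ)) < c := by
    have h1 : ρ * θ / (1 - ρ * θ) < t := by
      rw [div_lt_iff₀ (by linarith)]
      have h2 := (lt_div_iff₀ (show (0 : ℝ) < 1 + t by linarith)).1 hρθ'
      nlinarith
    have h3 : ρ * θ / (1 - ρ * θ) - θ / (1 - θ) < c / A := by rw [ht] at h1; linarith
    calc A * (ρ * θ / (1 - ρ * θ) - θ / (1 - θ)) < A * (c / A) := mul_lt_mul_of_pos_left h3 hA0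
      _ = c := by field_simp
  refine ⟨ρ, hρ1, 1 / ((c - A * (ρ * θ / (1 - ρ * θ) - θ / (1 - θ))) * (ρ - 1)), fun s => ?_⟩
  have h := abs_pwbAmp_sub_inv_pwbMean_le_kendall_of_cube_lt hy hθ hA hρ1 hρθ (by rw [← hM, ← hc]; exact hmargin) s
  rw [← hM, ← hc] at h
  calc |pwbAmp y s - (pwbMean y)⁻¹| ≤ ρ⁻¹ ^ s / ((c - A * (ρ * θ / (1 - ρ * θ) - θ / (1 - θ))) * (ρ - 1)) := h
    _ = 1 / ((c - A * (ρ * θ / (1 - ρ * θ) - θ / (1 - θ))) * (ρ - 1)) * ρ⁻¹ ^ s := by ring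

/-- The same geometric rate in the partition-function spelling: for every `y > μ³` there are `ρ > 1`, `K` with
`|PWB (2s) y / β(y)^{2s} − 1/m(y)| ≤ K ρ^{-s}` for all `s`. [cite: MadrasSlade1993, §4.2 Theorem 4.2.5 (p. 95)]
[cite: Bednorz2013, §2, Corollary 2.5 (p. 5)] -/
theorem exists_geometric_rate_PWB_div_of_cube_lt (hy : hexConnectiveConstant ^ 3 < y) :
    ∃ ρ : ℝ, 1 < ρ ∧ ∃ K : ℝ, ∀ s : ℕ, |PWB (2 * s) y / wallRate y ^ (2 * s) - (pwbMean y)⁻¹| ≤ K * ρ⁻¹ ^ s :=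
  exists_geometric_rate_pwbAmp_of_cube_lt hy

end Literature.Probability.RandomPlanarGeometry.SAW.HexBW.Wall

end
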